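import Mathlib
import HarnessLib
import Summits.Ventures.LatticeQCDFlow.Exactness.KennedyPendletonGamma
import Summits.Ventures.LatticeQCDFlow.Exactness.RejectionSampling
import Summits.Ventures.LatticeQCDFlow.Exactness.SU2HeatBathSampler

/-!
# The Kennedy–Pendleton `a₀` draw is exact: from four uniforms to `(2/π)√(1−a₀²) e^{bt·a₀} da₀`, and on to the SU(2) link law

HONEST FRAMING: exact (Metropolis-corrected) sampling algorithms for lattice gauge theory;
figures of merit are autocorrelation/cost numbers at stated couplings and volumes; no
continuum-physics claim.

Venture `LatticeQCDFlow` (cell pub-lqcd), topic `Exactness`, FANOUT row 9 (eng-latcore, the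
engine `latflow.core`).  NEW WORK of the cell over Mathlib and row 9's files
`KennedyPendletonGamma.lean` (the exponent is Gamma(3/2)), `RejectionSampling.lean` (the
repeat-until-accept loop outputs the normalised accepted part of one round) and
`SU2HeatBathSampler.lean` (assembling `a₀` and a uniform axis gives the link law).  Nothing here
is cited as a fact.  Printed counterparts, NAMED ONLY: Kennedy–Pendleton, Phys. Lett. B 156
(1985) 393; Gattringer–Lang 2010 eqs. (4.43)–(4.46).

This closes the entry "generating Kennedy–Pendleton's Gamma(3/2) proposal from uniforms" that
`RejectionSampling.lean`, `SU2HeatBathSampler.lean` and row 9's TYPED-EXACTNESS-MAP listed as NOT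
TYPED.  ONE ROUND of the engine (`csrc/latcore_template.c` `sample_a0`, branch `bt ≥ KP_SWITCH`;
`updates.py` `sample_a0_kp`), in idealised real arithmetic, reads four independent uniforms
`(r₁, r₂, r₃, r₄)`, forms `λ² = −(log r₁ + cos²(2π r₂) log r₃)/(2 bt) = kpX/(2 bt)`, proposes
`a₀ = 1 − 2λ²` and ACCEPTS iff `r₄² ≤ 1 − λ²`:

* `a0Law c = (2/π)√(1−t²) e^{ct} dt` — the unnormalised law the heat bath must draw `a₀` from at
  coupling `c = β·k` (acceptance test A3's reference density; the `a₀`-marginal of the link law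
  `e^{c a₀} dHaar`, `SU2A0Marginal.lean`); `a0Law_univ_ne_zero/_ne_top`.
* `kpStep bt`, **`kpRound bt`** — the round as a law on `ℝ × Bool` (value, accept-bit), the
  push-forward of `unitLaw3 ⊗ unitLaw`; `unitLaw_sq_le` — the engine's test `r² ≤ v` on a uniform
  `r` succeeds with probability `min(√v, 1)` (`= 0` for `v < 0`).
* **`accPart_kpRound`** — the accepted part of one round is `K(bt) • a0Law bt` with the explicit
  constant `kpConst bt = bt√bt e^{−bt} √π/√2`; **`kpRound_accept`** — the acceptance probability
  per round is `K(bt) · a0Law bt ℝ` (the engine's `stats[0]/stats[1]`).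
* **`loopLaw_kpRound`** — THE KENNEDY–PENDLETON LOOP IS EXACT: repeated until the first acceptance
  (`RejectionSampling.loopLaw`) it outputs `(a0Law bt ℝ)⁻¹ • a0Law bt`, the normalised A3 law, for
  every `bt > 0`; `isProbabilityMeasure_loopLaw_kpRound` — it halts almost surely.
* **`map_assembleSU2_loopLaw_kpRound`** — END TO END: drawing `a₀` by the Kennedy–Pendleton loop,
  the axis uniformly on `S²`, and assembling `a₀ + √(1−a₀²) n̂·Z⃗` (`assembleSU2`) produces EXACTLY
  the normalised one-link heat-bath law `(∫e^{bt a₀}dHaar)⁻¹ • e^{bt a₀(U)} dHaar(U)` on SU(2).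

NOT CLAIMED: floating point (the engine's uniforms are 53-bit, `log`/`cos`/`sqrt` are libm); the
`it < 10000` cap on rounds (the typed loop is unbounded; the cap returns `a₀ = 1` with probability
`(1 − acc)^10000`); the Creutz branch `bt < KP_SWITCH` (`CreutzSampler.lean`); the staple rotation
`U ↦ a ŝ†` (a Haar translation, `SubgroupHeatBath.lean` / `CabibboMarinariKernel.lean`).
-/

namespace Summit.Ventures.LatticeQCDFlow.Exactness

open MeasureTheory Measure Set Real
open scoped ENNReal

attribute [local fun_prop] measurable_kpX

/-! ## §1 A3's law `(2/π)√(1−t²) e^{ct} dt` and its mass -/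

/-- The unnormalised `a₀`-law at coupling `c`: `(2/π)√(1−t²) e^{ct} dt` (zero density off `[−1,1]`). -/
noncomputable def a0Law (c : ℝ) : Measure ℝ :=
  volume.withDensity fun t => ENNReal.ofReal (semicircleDensity t * Real.exp (c * t))

/-- `a0Law c` is, by `SU2A0Marginal.map_su2a0_linkLaw`, the `a₀`-image of the link law
`e^{c a₀(U)} dHaar(U)`; in particular it has the same total mass. -/
theorem a0Law_univ_eq (c : ℝ) : a0Law c univ =
    ((Literature.MathematicalPhysics.QuantumFieldTheory.haarProbability
        (Matrix.specialUnitaryGroup (Fin 2) ℂ)).withDensity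
          (fun U => ENNReal.ofReal (Real.exp (c * su2a0 U)))) univ := by
  rw [a0Law, ← map_su2a0_linkLaw c, Measure.map_apply continuous_su2a0.measurable MeasurableSet.univ,
    preimage_univ]

/-- The total mass of the link law is at most `e^{|c|}`. -/
theorem linkLaw_univ_le (c : ℝ) :
    ((Literature.MathematicalPhysics.QuantumFieldTheory.haarProbability
        (Matrix.specialUnitaryGroup (Fin 2) ℂ)).withDensity
          (fun U => ENNReal.ofReal (Real.exp (c * su2a0 U)))) univ ≤ ENNReal.ofReal (Real.exp |c|) := by
  rw [withDensity_apply _ MeasurableSet.univ, Measure.restrict_univ]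
  calc ∫⁻ U, ENNReal.ofReal (Real.exp (c * su2a0 U))
        ∂(Literature.MathematicalPhysics.QuantumFieldTheory.haarProbability
          (Matrix.specialUnitaryGroup (Fin 2) ℂ))
      ≤ ∫⁻ _, ENNReal.ofReal (Real.exp |c|)
        ∂(Literature.MathematicalPhysics.QuantumFieldTheory.haarProbability
          (Matrix.specialUnitaryGroup (Fin 2) ℂ)) := by
        refine lintegral_mono fun U => ENNReal.ofReal_le_ofReal (Real.exp_le_exp.mpr ?_)
        calc c * su2a0 U ≤ |c * su2a0 U| := le_abs_self _
          _ = |c| * |su2a0 U| := abs_mul _ _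
          _ ≤ |c| * 1 := mul_le_mul_of_nonneg_left (abs_su2a0_le_one U) (abs_nonneg c)
          _ = |c| := mul_one _
    _ = ENNReal.ofReal (Real.exp |c|) := by rw [lintegral_const, measure_univ, mul_one]

/-- The total mass of the link law is at least `e^{−|c|}`. -/
theorem le_linkLaw_univ (c : ℝ) :
    ENNReal.ofReal (Real.exp (-|c|)) ≤ ((Literature.MathematicalPhysics.QuantumFieldTheory.haarProbability
        (Matrix.specialUnitaryGroup (Fin 2) ℂ)).withDensity
          (fun U => ENNReal.ofReal (Real.exp (c * su2a0 U)))) univ := by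
  rw [withDensity_apply _ MeasurableSet.univ, Measure.restrict_univ]
  calc ENNReal.ofReal (Real.exp (-|c|))
      = ∫⁻ _, ENNReal.ofReal (Real.exp (-|c|))
        ∂(Literature.MathematicalPhysics.QuantumFieldTheory.haarProbability
          (Matrix.specialUnitaryGroup (Fin 2) ℂ)) := by rw [lintegral_const, measure_univ, mul_one]
    _ ≤ _ := by
        refine lintegral_mono fun U => ENNReal.ofReal_le_ofReal (Real.exp_le_exp.mpr ?_)
        calc -|c| ≤ -|c * su2a0 U| := by
              rw [abs_mul, neg_le_neg_iff]
              exact (mul_le_mul_of_nonneg_left (abs_su2a0_le_one U) (abs_nonneg c)).trans_eq (mul_one _)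
          _ ≤ c * su2a0 U := neg_abs_le _

/-- `a0Law c` has finite mass. -/
theorem a0Law_univ_ne_top (c : ℝ) : a0Law c univ ≠ ∞ := by
  rw [a0Law_univ_eq]
  exact ne_top_of_le_ne_top ENNReal.ofReal_ne_top (linkLaw_univ_le c)

/-- `a0Law c` has non-zero mass. -/
theorem a0Law_univ_ne_zero (c : ℝ) : a0Law c univ ≠ 0 := by
  rw [a0Law_univ_eq]
  exact (lt_of_lt_of_le (ENNReal.ofReal_pos.mpr (Real.exp_pos _)) (le_linkLaw_univ c)).ne'

/-- Off `(−1, 1)` — in particular at `|t| ≥ 1` — A3's density vanishes. -/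
theorem semicircleDensity_eq_zero_of_one_le_abs {t : ℝ} (ht : 1 ≤ |t|) : semicircleDensity t = 0 := by
  have h : 1 - t ^ 2 ≤ 0 := by nlinarith [sq_abs t, abs_nonneg t]
  rw [semicircleDensity, Real.sqrt_eq_zero'.mpr h, mul_zero]

/-! ## §2 The engine's acceptance test on a uniform deviate -/

/-- **The test `r² ≤ v` on a uniform `r` succeeds with probability `min(√v, 1)`** (`√v = 0` for
`v ≤ 0`). -/
theorem unitLaw_sq_le (v : ℝ) : unitLaw {r : ℝ | r ^ 2 ≤ v} = ENNReal.ofReal (min (Real.sqrt v) 1) := by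
  rw [unitLaw_apply (s := {r : ℝ | r ^ 2 ≤ v})
    (measurableSet_le (by fun_prop : Measurable fun r : ℝ => r ^ 2) measurable_const)]
  have hset : {r : ℝ | r ^ 2 ≤ v} ∩ Ioo 0 1 = Ioo 0 1 ∩ Iic (Real.sqrt v) := by
    ext r
    simp only [mem_inter_iff, mem_setOf_eq, mem_Ioo, mem_Iic]
    constructor
    · rintro ⟨h, h0, h1⟩; exact ⟨⟨h0, h1⟩, (Real.le_sqrt' h0).mpr h⟩
    · rintro ⟨⟨h0, h1⟩, h⟩; exact ⟨(Real.le_sqrt' h0).mp h, h0, h1⟩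
  rw [hset]
  by_cases hs : Real.sqrt v < 1
  · have h2 : Ioo (0 : ℝ) 1 ∩ Iic (Real.sqrt v) = Ioc 0 (Real.sqrt v) := by
      ext r
      simp only [mem_inter_iff, mem_Ioo, mem_Iic, mem_Ioc]
      constructor
      · rintro ⟨⟨h0, -⟩, h⟩; exact ⟨h0, h⟩
      · rintro ⟨h0, h⟩; exact ⟨⟨h0, lt_of_le_of_lt h hs⟩, h⟩
    rw [min_eq_left hs.le, h2, Real.volume_Ioc, sub_zero]
  · have h2 : Ioo (0 : ℝ) 1 ∩ Iic (Real.sqrt v) = Ioo 0 1 :=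
      inter_eq_left.mpr fun r hr => le_trans hr.2.le (not_lt.mp hs)
    rw [min_eq_right (not_lt.mp hs), h2, Real.volume_Ioo, sub_zero, ENNReal.ofReal_one]

/-- A decidable measurable predicate gives a measurable `Bool`-valued map. -/
theorem measurable_decide {α : Type*} [MeasurableSpace α] {p : α → Prop} [DecidablePred p]
    (hp : MeasurableSet {a | p a}) : Measurable fun a => decide (p a) := by
  refine measurable_to_countable' fun b => ?_
  cases b
  · convert hp.compl using 1
    ext a; simp
  · convert hp using 1
    ext a; simp

/-! ## §3 One Kennedy–Pendleton round -/

section KP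

variable {bt : ℝ}

/-- Probability that the engine's test `r₄² ≤ 1 − λ² = (1 + a₀)/2` accepts the proposed `a₀`. -/
noncomputable def kpAccept (a : ℝ) : ℝ≥0∞ := ENNReal.ofReal (min (Real.sqrt ((1 + a) / 2)) 1)

/-- `kpAccept` is measurable. -/
theorem measurable_kpAccept : Measurable kpAccept := by
  refine ENNReal.measurable_ofReal.comp (Continuous.measurable ?_)
  exact ((Real.continuous_sqrt.comp ((continuous_const.add continuous_id).div_const _)).min
    continuous_const)

/-- For `a < −1` the test never accepts. -/
theorem kpAccept_of_lt {a : ℝ} (ha : a < -1) : kpAccept a = 0 := by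
  rw [kpAccept, Real.sqrt_eq_zero'.mpr (by linarith), min_eq_left zero_le_one, ENNReal.ofReal_zero]

/-- For `−1 ≤ a ≤ 1` the test accepts with probability `√((1+a)/2)`. -/
theorem kpAccept_of_mem {a : ℝ} (ha : a ≤ 1) : kpAccept a = ENNReal.ofReal (Real.sqrt ((1 + a) / 2)) := by
  rw [kpAccept, min_eq_left]
  rw [show (1 : ℝ) = Real.sqrt 1 from Real.sqrt_one.symm]
  exact Real.sqrt_le_sqrt (by rw [Real.sqrt_one]; linarith)

/-- **One Kennedy–Pendleton round, as the engine runs it**: from the four uniforms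
`ω = ((r₁, r₂, r₃), r₄)` propose `a₀ = 1 − 2λ² = 1 − kpX/bt` and accept iff `r₄² ≤ 1 − λ²`. -/
noncomputable def kpStep (bt : ℝ) (ω : (ℝ × ℝ × ℝ) × ℝ) : ℝ × Bool :=
  (1 - kpX ω.1 / bt, decide (ω.2 ^ 2 ≤ 1 - kpX ω.1 / (2 * bt)))

/-- `kpStep` is measurable. -/
theorem measurable_kpStep (bt : ℝ) : Measurable (kpStep bt) := by
  unfold kpStep
  refine Measurable.prodMk (by fun_prop) (measurable_decide ?_)
  exact measurableSet_le (by fun_prop : Measurable fun ω : (ℝ × ℝ × ℝ) × ℝ => ω.2 ^ 2)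
    (by fun_prop : Measurable fun ω : (ℝ × ℝ × ℝ) × ℝ => 1 - kpX ω.1 / (2 * bt))

/-- The law of one Kennedy–Pendleton round on `ℝ × Bool` (proposed value, accept-bit). -/
noncomputable def kpRound (bt : ℝ) : Measure (ℝ × Bool) := (unitLaw3.prod unitLaw).map (kpStep bt)

/-- One round is a probability law. -/
instance isProbabilityMeasure_kpRound (bt : ℝ) : IsProbabilityMeasure (kpRound bt) :=
  isProbabilityMeasure_map (measurable_kpStep bt).aemeasurable

/-- The Kennedy–Pendleton constant `K(bt) = bt √bt e^{−bt} √π / √2`. -/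
noncomputable def kpConst (bt : ℝ) : ℝ≥0∞ :=
  ENNReal.ofReal (bt * Real.sqrt bt * Real.exp (-bt) * Real.sqrt π / Real.sqrt 2)

/-- `K(bt) ≠ 0` for `bt > 0`. -/
theorem kpConst_ne_zero (hbt : 0 < bt) : kpConst bt ≠ 0 := by
  rw [kpConst, Ne, ENNReal.ofReal_eq_zero, not_le]
  have : 0 < Real.sqrt bt := Real.sqrt_pos.mpr hbt
  positivity

/-- `K(bt)` is finite. -/
theorem kpConst_ne_top : kpConst bt ≠ ∞ := ENNReal.ofReal_ne_top

/-- The pointwise density identity behind Kennedy–Pendleton: for `t ≤ 1`,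
`bt · γ₃⁄₂(bt(1−t)) · √((1+t)/2) = K(bt) · (2/π)√(1−t²) e^{bt t}` with `γ₃⁄₂(s) = (2/√π)√s e^{−s}`. -/
theorem kp_pointwise (hbt : 0 < bt) {t : ℝ} (ht : t ≤ 1) :
    bt * (2 / Real.sqrt π * Real.sqrt (bt * (1 - t)) * Real.exp (-(bt * (1 - t)))) *
        Real.sqrt ((1 + t) / 2) =
      bt * Real.sqrt bt * Real.exp (-bt) * Real.sqrt π / Real.sqrt 2 *
        (semicircleDensity t * Real.exp (bt * t)) := by
  rw [semicircleDensity, show 1 - t ^ 2 = (1 + t) * (1 - t) by ring,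
    Real.sqrt_mul' (1 + t) (show 0 ≤ 1 - t by linarith), Real.sqrt_mul hbt.le (1 - t),
    Real.sqrt_div' (1 + t) zero_le_two, show -(bt * (1 - t)) = -bt + bt * t by ring, Real.exp_add]
  set p := Real.sqrt π with hp
  have hp0 : 0 < p := Real.sqrt_pos.mpr pi_pos
  have hππ : p * p = π := Real.mul_self_sqrt pi_pos.le
  rw [← hππ]
  have h2 : 0 < Real.sqrt 2 := by positivity
  field_simp

/-- **The accepted part of one Kennedy–Pendleton round**: for measurable `A`,
`P(a₀ ∈ A, accept) = K(bt) · a0Law bt A`. -/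
theorem kpRound_apply_prod_true (hbt : 0 < bt) {A : Set ℝ} (hA : MeasurableSet A) :
    kpRound bt (A ×ˢ {true}) = kpConst bt * a0Law bt A := by
  have hS : MeasurableSet {ω : (ℝ × ℝ × ℝ) × ℝ |
      1 - kpX ω.1 / bt ∈ A ∧ ω.2 ^ 2 ≤ 1 - kpX ω.1 / (2 * bt)} :=
    (hA.preimage (by fun_prop : Measurable fun ω : (ℝ × ℝ × ℝ) × ℝ => 1 - kpX ω.1 / bt)).inter
      (measurableSet_le (by fun_prop : Measurable fun ω : (ℝ × ℝ × ℝ) × ℝ => ω.2 ^ 2)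
        (by fun_prop : Measurable fun ω : (ℝ × ℝ × ℝ) × ℝ => 1 - kpX ω.1 / (2 * bt)))
  have hpre : kpStep bt ⁻¹' (A ×ˢ {true}) =
      {ω : (ℝ × ℝ × ℝ) × ℝ | 1 - kpX ω.1 / bt ∈ A ∧ ω.2 ^ 2 ≤ 1 - kpX ω.1 / (2 * bt)} := by
    ext ω
    simp only [kpStep, mem_preimage, mem_prod, mem_singleton_iff, decide_eq_true_eq, mem_setOf_eq]
  rw [kpRound, Measure.map_apply (measurable_kpStep bt) (hA.prod (measurableSet_singleton _)), hpre,
    Measure.prod_apply hS]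
  -- the `r₄`-slices
  have hslice : ∀ r : ℝ × ℝ × ℝ, unitLaw (Prod.mk r ⁻¹' {ω : (ℝ × ℝ × ℝ) × ℝ |
      1 - kpX ω.1 / bt ∈ A ∧ ω.2 ^ 2 ≤ 1 - kpX ω.1 / (2 * bt)}) = A.indicator kpAccept (1 - kpX r / bt) := by
    intro r
    by_cases hr : 1 - kpX r / bt ∈ A
    · have : Prod.mk r ⁻¹' {ω : (ℝ × ℝ × ℝ) × ℝ | 1 - kpX ω.1 / bt ∈ A ∧ ω.2 ^ 2 ≤ 1 - kpX ω.1 / (2 * bt)}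
          = {r₄ : ℝ | r₄ ^ 2 ≤ 1 - kpX r / (2 * bt)} := by
        ext r₄
        simp only [mem_preimage, mem_setOf_eq]
        exact ⟨fun h => h.2, fun h => ⟨hr, h⟩⟩
      rw [indicator_of_mem hr, kpAccept, this, unitLaw_sq_le,
        show (1 + (1 - kpX r / bt)) / 2 = 1 - kpX r / (2 * bt) by field_simp; ring]
    · have : Prod.mk r ⁻¹' {ω : (ℝ × ℝ × ℝ) × ℝ | 1 - kpX ω.1 / bt ∈ A ∧ ω.2 ^ 2 ≤ 1 - kpX ω.1 / (2 * bt)}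
          = ∅ := by
        ext r₄
        simp only [mem_preimage, mem_setOf_eq, mem_empty_iff_false, iff_false, not_and]
        exact fun h => absurd h hr
      rw [indicator_of_notMem hr, this, measure_empty]
  simp_rw [hslice]
  -- the law of the exponent is Gamma(3/2)
  rw [lintegral_kpX (g := fun x => A.indicator kpAccept (1 - x / bt))
    ((measurable_kpAccept.indicator hA).comp (by fun_prop))]
  -- substitute `s = bt (1 − t)`
  have himg : (fun t : ℝ => bt * (1 - t)) '' Iio 1 = Ioi 0 := by
    ext s
    constructor
    · rintro ⟨t, ht, rfl⟩; exact mul_pos hbt (by simpa using ht)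
    · intro hs
      exact ⟨1 - s / bt, by simpa using div_pos hs hbt, by
        simp only [sub_sub_cancel]; rw [← mul_div_assoc, mul_div_cancel_left₀ _ hbt.ne']⟩
  have hderiv : ∀ t ∈ Iio (1 : ℝ), HasDerivWithinAt (fun t : ℝ => bt * (1 - t)) (bt * -1) (Iio 1) t :=
    fun t _ => (((hasDerivAt_id' t).const_sub 1).const_mul bt).hasDerivWithinAt
  have hinj : InjOn (fun t : ℝ => bt * (1 - t)) (Iio 1) := by
    intro s _ t _ h
    have := mul_left_cancel₀ hbt.ne' h
    linarith
  rw [← himg, lintegral_image_eq_lintegral_abs_deriv_mul measurableSet_Iio hderiv hinj]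
  -- compare with `K • a0Law` pointwise
  rw [a0Law, withDensity_apply _ hA, ← lintegral_indicator hA, ← lintegral_indicator measurableSet_Iio,
    ← lintegral_const_mul' _ _ kpConst_ne_top]
  refine lintegral_congr fun t => ?_
  have hsub : 1 - bt * (1 - t) / bt = t := by
    rw [mul_div_cancel_left₀ _ hbt.ne', sub_sub_cancel]
  simp only [indicator_apply, mem_Iio, hsub, mul_neg_one, abs_neg, abs_of_pos hbt]
  by_cases htA : t ∈ A
  · rw [indicator_of_mem htA, indicator_of_mem htA]
    by_cases ht1 : t < 1
    · rw [if_pos ht1]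
      by_cases ht0 : -1 ≤ t
      · -- the density identity
        rw [kpAccept_of_mem ht1.le, kpConst]
        have hγ : 0 ≤ 2 / Real.sqrt π * Real.sqrt (bt * (1 - t)) * Real.exp (-(bt * (1 - t))) := by
          positivity
        have hK : 0 ≤ bt * Real.sqrt bt * Real.exp (-bt) * Real.sqrt π / Real.sqrt 2 := by
          have := Real.sqrt_pos.mpr hbt
          positivity
        rw [← ENNReal.ofReal_mul hγ, ← ENNReal.ofReal_mul hbt.le, ← ENNReal.ofReal_mul hK, ← mul_assoc,
          kp_pointwise hbt ht1.le]
      · -- `t < −1`: both sides vanish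
        rw [kpAccept_of_lt (not_le.mp ht0),
          semicircleDensity_eq_zero_of_one_le_abs (by rw [abs_of_neg (by linarith)]; linarith)]
        simp
    · -- `t ≥ 1`: both sides vanish
      rw [if_neg ht1, semicircleDensity_eq_zero_of_one_le_abs (by rw [abs_of_nonneg (by linarith)]; linarith)]
      simp
  · rw [indicator_of_notMem htA, indicator_of_notMem htA]
    simp

/-- **The accepted part of one round is `K(bt) • a0Law bt`.** -/
theorem accPart_kpRound (hbt : 0 < bt) : accPart (kpRound bt) = kpConst bt • a0Law bt := by
  ext A hA
  rw [accPart_apply hA, Measure.smul_apply, smul_eq_mul, kpRound_apply_prod_true hbt hA]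

/-- **Cost**: one Kennedy–Pendleton round accepts with probability `K(bt) · a0Law bt ℝ`. -/
theorem kpRound_accept (hbt : 0 < bt) : kpRound bt (univ ×ˢ {true}) = kpConst bt * a0Law bt univ :=
  kpRound_apply_prod_true hbt MeasurableSet.univ

/-- **THE KENNEDY–PENDLETON LOOP IS EXACT.**  For every `bt > 0`, repeating the round until the first
acceptance outputs the normalised A3 law `(a0Law bt ℝ)⁻¹ • a0Law bt = Z⁻¹ (2/π)√(1−t²) e^{bt t} dt`. -/
theorem loopLaw_kpRound (hbt : 0 < bt) : loopLaw (kpRound bt) = (a0Law bt univ)⁻¹ • a0Law bt := by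
  rw [loopLaw_eq, kpRound_accept hbt, accPart_kpRound hbt, smul_smul,
    ENNReal.mul_inv (Or.inl (kpConst_ne_zero hbt)) (Or.inl kpConst_ne_top), mul_comm (kpConst bt)⁻¹,
    mul_assoc, ENNReal.inv_mul_cancel (kpConst_ne_zero hbt) kpConst_ne_top, mul_one]

/-- … and the loop halts almost surely: its output law is a probability measure. -/
theorem isProbabilityMeasure_loopLaw_kpRound (hbt : 0 < bt) : IsProbabilityMeasure (loopLaw (kpRound bt)) :=
  isProbabilityMeasure_loopLaw (by
    rw [kpRound_accept hbt]; exact mul_ne_zero (kpConst_ne_zero hbt) (a0Law_univ_ne_zero bt))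

/-! ## §4 End to end: the SU(2) link heat bath from uniforms -/

/-- `SU2HeatBathSampler.map_assembleSU2_linkLaw` in the vocabulary of `a0Law`. -/
theorem map_assembleSU2_a0Law (c : ℝ) :
    ((a0Law c).prod (uniformSphere (volume : Measure E3))).map assembleSU2 =
      (Literature.MathematicalPhysics.QuantumFieldTheory.haarProbability
        (Matrix.specialUnitaryGroup (Fin 2) ℂ)).withDensity (fun U => ENNReal.ofReal (Real.exp (c * su2a0 U))) :=
  map_assembleSU2_linkLaw c

/-- **The engine's SU(2) heat bath is exact from the uniforms up.**  Drawing `a₀` by the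
Kennedy–Pendleton loop, the axis uniformly on `S²`, independently, and assembling
`a₀ + √(1−a₀²) n̂·Z⃗` produces EXACTLY the normalised one-link heat-bath law
`(∫ e^{bt a₀} dHaar)⁻¹ • e^{bt a₀(U)} dHaar(U)` (`bt = β k > 0`). -/
theorem map_assembleSU2_loopLaw_kpRound (hbt : 0 < bt) :
    ((loopLaw (kpRound bt)).prod (uniformSphere (volume : Measure E3))).map assembleSU2 =
      ((Literature.MathematicalPhysics.QuantumFieldTheory.haarProbability
          (Matrix.specialUnitaryGroup (Fin 2) ℂ)).withDensity
            (fun U => ENNReal.ofReal (Real.exp (bt * su2a0 U))) univ)⁻¹ •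
        (Literature.MathematicalPhysics.QuantumFieldTheory.haarProbability
          (Matrix.specialUnitaryGroup (Fin 2) ℂ)).withDensity
            (fun U => ENNReal.ofReal (Real.exp (bt * su2a0 U))) := by
  rw [loopLaw_kpRound hbt, Measure.prod_smul_left, Measure.map_smul, map_assembleSU2_a0Law,
    a0Law_univ_eq]

end KP

end Summit.Ventures.LatticeQCDFlow.Exactness
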